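import Summits.HubbardSuperconductivity.HubbardSuperconductivity.Theorems.SgCorridor.Negative.AnchorFreezeMain

/-!
# Refutation of `ColourTheSpin.SgAnchorOrder` (stmt-HubbardSuperconductivity-16273): electric freezing

Route `HubbardSuperconductivity/ColourTheSpin` ("gauge the spin by a removable `Q8` link field"), rank-3
crux `SgAnchorOrder` (the STRONG-COUPLING ANCHOR, card K1) asserts: there are `U > 0`, `δ ∈ (0,1/2)`,
`g₀ > 0`, `c > 0`, `L₀` such that for ALL gauge couplings `g ≥ g₀` and all even `L ≥ L₀` every ground
state `ψ` of the `N_L`-particle block of the `Q8`-spin-gauged Hubbard torus `H_g(L,U)` (all Gauss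
sectors) has gauged `B1g` pair order `c·L⁴·‖ψ‖² ≤ ⟨ψ, Δ_d^g† Δ_d^g ψ⟩`.

**This is false, for every `(U, δ, g₀, c, L₀)`** (`ColourTheSpinSgAnchorOrder_refuted`), by ELECTRIC
FREEZING as `g → ∞` along the half-line the item quantifies over:

1. *Trial state.* The link-constant (flux-free) vector `τ = |s₀⟩ ⊗ 1` (any occupation set `s₀` with
   `#s₀ = N_L`) has NO electric energy (`E_b` kills functions constant in link `b`: the row sums
   `Σ_u (δ_{k_b,u} - 1/8)` of the inlined electric matrix vanish), hopping form `≥ -16L²‖τ‖²`,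
   repulsion `≤ U L²‖τ‖²`, magnetic weight `≤ 2L²/g²·‖τ‖²`. So the block ground energy is
   `E ≤ (18 + U) L²` for `g ≥ 1` — uniformly in `g` (`re_HQ_trial_le`).
2. *Lower bound.* `H_g ≥ -(hop + hop†) + g² Σ_b E_b ≥ -16 L² + g² Σ_b E_b` (repulsion and magnetic
   weight are `≥ 0`; `|ρ(u)_{στ}| ≤ 1`), hence every ground state has electric excitation
   `g² Σ_b ‖E_b ψ‖² ≤ (34 + U) L² ‖ψ‖²` (`ground_electric_le`).
3. *Decorrelation.* `Δ_d^g = Σ_b Δ_b`, `‖Δ_b‖ ≤ 4`, and — the heart of the matter — the transported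
   singlet weight `(ερ(u))_{στ}` has ZERO MEAN over `u ∈ Q8` (`Σ_u ρ(u) = 0`, Schur/Elitzur), so
   `A_b Δ_b A_b = 0` for the flux-free projection `A_b = 1 - E_b` of link `b`, while `Δ_{b'}`
   commutes with `A_b` for `b' ≠ b`. Consequently every cross term is paid for by an excited link:
   `|⟨Δ_b ψ, Δ_{b'} ψ⟩| ≤ 32 ‖ψ‖ ‖E_b ψ‖`, and
   `⟨ψ, Δ_d^g† Δ_d^g ψ⟩ = ‖Δ^g ψ‖² ≤ 32 L² ‖ψ‖² + 64 L² ‖ψ‖ Σ_b ‖E_b ψ‖` (`eucNorm_PQ_mulVec_sq_le`).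
4. With Cauchy–Schwarz over the `2L²` bonds and step 2, `‖Δ^g ψ‖² ≤ (3c/4) L⁴ ‖ψ‖² < c L⁴ ‖ψ‖²` as
   soon as `g² ≥ 32768 (34 + U)/c²` and `L² ≥ 128/c` (`not_blockOrder`). Witness inside the item's
   quantifiers: `g = max(g₀, 1, 32768(34+U)/c² + 1)`, `L = 2(L₀ + ⌈128/c⌉ + 1)` (even, `≥ L₀`).

PHYSICS. At string tension `g² ≫ U, t` every link freezes into the flux-free wave-function; the
gauge-INVARIANT bond pair field necessarily drags a string (excites its link), so its two-point
function has no long-range part: `O(L²) + O(L⁴/g)`. "Confinement glues singlet pairs with a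
`g`-independent effective model" (the item's rationale) is wrong at leading order — the bond-pair weight
of the confined effective model is `O(t/g²)`; the argument is blind to Gauss sectors (the doublon product
trial state is gauge invariant too), so restricting to the physical sector does not help.

CLASS: `refuted-misstated`. The witness exploits the UNIFORMITY "one `c` for all `g ≥ g₀`" (the
planner's stated belief that the `g ≥ g₀` effective model is `g`-independent). Minimal repair `C′`:
anchor at ONE coupling, `∃ U > 0, ∃ δ ∈ Ioo 0 (1/2), ∃ g₀ > 0, ∃ c > 0, ∃ L₀, ∀ L ≥ L₀ even,
BlockOrder L U δ g₀ c` (equivalently: let `c` depend on `g` on compact windows). The witness MISSES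
`C′` (the bound bites only for `g² ≳ 3·10⁴ (34+U)/c²`), but note that `C′` loses the item's only
rationale (strong confinement): the frozen regime is NOT superconducting, so any true anchor sits at
intermediate `g ~ √U` where no rigorous technology exists.

CONSEQUENCES in the route file: `SgCorridor := SgAnchorOrder → SgCorridorOrder`
(stmt-HubbardSuperconductivity-16274) is VACUOUSLY TRUE (`fun h => (…_refuted h).elim`, attached as
evidence on that item, a prover's landing), and so are both stubs of its birth skeleton
(`HalfLineOrder U δ` is false for every `U ≥ 0`, `δ ≥ 0` by `not_blockOrder_eventually`); the
route's content collapses onto the rank-0 target `SgCorridorOrder` + `SgEndpoint`.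

Everything is elementary finite-dimensional linear algebra over the verbatim inlined objects of the
route file, carried out in `Theorems/SgCorridor/Negative/AnchorFreeze{Averaging,Model,Bounds,Main}.lean`
(objects named `rQ, hopQ, HQ, PQ, pN, BlockOrder`; `sgAnchorOrder_iff` is `Iff.rfl`); this file only
restates `SgAnchorFreeze.not_blockOrder_eventually` as the literal negation of the route decl. No facts,
no cites beyond folklore (Kogut–Susskind electric term; Elitzur/Schur orthogonality `Σ_{u∈G} ρ(u) = 0`
for a non-trivial irrep). Refuter crux-attack, 2026-08-17.
-/

-- `HubbardSuperconductivity.HubbardSuperconductivity` is the mandated Summit/Sub namespace (D-0017).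
set_option linter.dupNamespace false

namespace Summit.HubbardSuperconductivity.HubbardSuperconductivity.Theorems

/-- **Refutes `ColourTheSpin.SgAnchorOrder`** (stmt-HubbardSuperconductivity-16273) [refuted-misstated]:
the strong-coupling anchor asks for ONE pair-order constant `c` for ALL gauge couplings `g ≥ g₀`; but as
`g → ∞` the electric term freezes every link into the flux-free wave-function, every ground state of the
`N_L`-block has electric excitation `O(L²/g²)‖ψ‖²`, and the gauge-invariant bond pair field always
excites its link (`Σ_{u∈Q8} ρ(u) = 0`), so `⟨Δ^g†Δ^g⟩ ≤ 32L²‖ψ‖² + O(L⁴/g)‖ψ‖² < cL⁴‖ψ‖²`.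
Witness: `g = max(g₀, 1, 32768(34+U)/c² + 1)`, `L = 2(L₀ + ⌈128/c⌉ + 1)`
(`SgAnchorFreeze.not_blockOrder_eventually`, via the definitional bridge `SgAnchorFreeze.sgAnchorOrder_iff`).
Repaired statement `C′`: anchor at a single coupling `g₀` (drop `∀ g ≥ g₀`) or let the constant depend
on `g`; the witness misses `C′`. See the module docstring. [folklore] -/
theorem ColourTheSpinSgAnchorOrder_refuted :
    ¬ Summit.HubbardSuperconductivity.HubbardSuperconductivity.Theses.ColourTheSpin.SgAnchorOrder := by
  rw [SgAnchorFreeze.sgAnchorOrder_iff]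
  rintro ⟨U, hU, δ, hδ, g₀, -, c, hc, L₀, h⟩
  obtain ⟨g, hg, L, _, hL₀, hev, hnot⟩ :=
    SgAnchorFreeze.not_blockOrder_eventually U δ c hU.le hδ.1.le hc g₀ L₀
  exact hnot (h g hg L hL₀ hev)

end Summit.HubbardSuperconductivity.HubbardSuperconductivity.Theorems
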